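import Mathlib
import HarnessLib
import HarnessLib.Audit
import Summits.SmoothPoincare4.Statement
import Literature.Geometry.Manifold.LipschitzClarkeRegular
import Literature.Topology.FourManifolds.HomotopyS4CompactProofs
import HarnessLib.Audit.Status.Attr

/-!
Route: LipschitzHauptvermutung

# Route LipschitzHauptvermutung — Lipschitz Hauptvermutung for homotopy 4-spheres, then Clarke
regularisation to a diffeomorphism

It suffices to show X = K1 ∧ K2 where K1 (`LipStandard`): every smooth homotopy 4-sphere M (the
summit binders, M ≃ₕ S⁴) admits a
homeomorphism h : M → S⁴ that is locally Lipschitz in charts together with its inverse (=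
bi-Lipschitz for smooth Riemannian
distances; "the Lipschitz structure underlying the smooth structure is standard"), and K2
(`ClarkeRegularisation`): whenever such a
bi-Lipschitz comparison map exists, one exists whose chart representatives (and those of its
inverse) have Clarke generalised
Jacobians consisting of invertible maps at every point. The printed Kondo–Tanaka recognition theorem
(support item `KtRecognition`,
Literature named fact `KondoTanakaRecognition`, arXiv:1408.6036 Cor. 1.10) turns such a map into a
diffeomorphism M ≅ S⁴.
Realises the markdown-first sketch `mwave/sketch/SmoothPoincare4/lipschitz-hauptvermutung` (passed
paper-judge; K1 = its K1, K2 = its K2, F = its support F); no idea card of that slug exists in the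
summit index, so none is linked.
Lean: `Summit.SmoothPoincare4.SmoothPoincare4.Theses.LipschitzHauptvermutung.LipStandard ∧
Summit.SmoothPoincare4.SmoothPoincare4.Theses.LipschitzHauptvermutung.ClarkeRegularisation`

## Assembly
Pure logic over the summit binders (certified in folder/Sketch.lean and glue.lean, rc 0): given M
with the Statement's binders and
e : M ≃ₕ S⁴, M is compact
(`Literature.Topology.FourManifolds.compactSpace_of_homotopyEquiv_sphere_four_holds`), `LipStandard
M e` gives a
bi-Lipschitz-in-charts h, `ClarkeRegularisation M e ⟨h, …⟩` gives a Clarke-regular one, and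
`KtRecognition 4 M S⁴ h …` returns
`Nonempty (M ≃ₘ⟮𝓡 4, 𝓡 4⟯ S⁴)`, i.e. `SmoothPoincare4`. The implication `Assembly : LipStandard →
ClarkeRegularisation → KtRecognition →
SmoothPoincare4` is the Assembly item (pure logic, provable now — recipe: `intro h₁ h₂ hF M _ _ _ _
_ e; haveI :=
compactSpace_of_homotopyEquiv_sphere_four_holds M e; obtain ⟨h, hL, hL', hC, hC'⟩ := h₂ M e (h₁ M
e); exact hF 4 M S⁴ h hL hL' hC hC'`,
certified in folder/Sketch.lean `assembly_proof`), and `closes (hA : Assembly) (h₁ : LipStandard)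
(h₂ : ClarkeRegularisation) (hF :
KtRecognition) : SmoothPoincare4 := hA h₁ h₂ hF` consumes all four items.

Rationale: WHY THIS LINE. Between TOP and DIFF sit the pseudo-groups on which first-order analysis works:
quasiconformal ⊃ bi-Lipschitz ⊃ {bi-Lipschitz and
Clarke-regular} = DIFF, the last equality being a theorem (KondoTanaka2017, Cor. 1.10: mollification
of a Clarke-regular bi-Lipschitz
homeomorphism between closed smooth manifolds is a diffeomorphism). Sullivan1979Hyperbolic gives TOP
= LIP in every dimension ≠ 4
(Cor. 3, p.548 of the Cantrell volume), DonaldsonSullivanActa1989 shows that in dimension 4 LIP is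
strictly finer than TOP and carries
Yang–Mills theory (Thms 1–2), and CristofarogardinerZhang2026 (Thm 1.1/4.3) shows Sullivan's
torus-trick smoothing extends to
dimension 4 exactly where local C⁰-approximation by bi-Lipschitz embeddings is available; whether
LIP-equivalent smooth 4-manifolds are
diffeomorphic is open (Martin2013 §8.2). The route cuts SPC4 at the Lipschitz rung: K1 is
quantitative topology (Freedman/Quinn's
almost-smooth Hauptvermutung made uniformly bi-Lipschitz off an H³-null singular set, plus an
elementary removability lemma), K2 is
nonsmooth analysis of one bounded measurable matrix field Dh ∈ L^∞(S⁴; GL₄ℝ) (Clarke1976 calculus,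
singular-set stratification, one-point
removal). Imported areas: Lipschitz/quasiconformal geometric topology and nonsmooth analysis; no
open or dead route of this summit
changes the CATEGORY of the comparison map (negatives index empty; 65 Theses checked by `exact?`
dedup).

RANKED CRUXES. #2 LipStandard (crux) — K1 of the sketch — every smooth homotopy 4-sphere M (summit
binders, M ≃ₕ S⁴) admits a homeomorphism h : M ≃ₜ S⁴ with h and h⁻¹ locally Lipschitz in the
extended charts (𝓡 4) at every point. [difficulty: XL] (why it might fail: LIP-approximation of
homeomorphisms fails in dim 4 in general (DS 1989 Cor. p.183: CP²#8(−CP²) vs Barlow are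
homeomorphic, not bi-Lipschitz); an exotic S⁴ could carry an exotic LIP structure invisible to gauge
theory (b₂ = 0), and Quinn 8.1A gives no metric control.) [DonaldsonSullivanActa1989,
Sullivan1979Hyperbolic, CristofarogardinerZhang2026, FreedmanQuinn1990, KondoTanaka2017,
TukiaVaisala1981]
#3 ClarkeRegularisation (crux) — K2 of the sketch — for every smooth homotopy 4-sphere M: if some
homeomorphism M ≃ₜ S⁴ is locally Lipschitz in charts with its inverse, then some such homeomorphism
is moreover Clarke-regular in charts in both directions (every element of the Clarke generalised
Jacobian of every chart representative is invertible). [deps: LipStandard] [difficulty: XL] (why it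
might fail: the 7-dimensional analogue is FALSE (every exotic S⁷ is bi-Lipschitz-standard by a map
smooth off one point, KondoTanaka2017 Cor. 1.15), so the proof must use dimension 4; naive
ε-regularity is false (logarithmic-spiral bi-Lipschitz maps have 0 in the Clarke hull);
SPC4-shielded shape (§D.1).) [KondoTanaka2017, Clarke1976, Shikata1966, IwaniecMartin2001,
KervaireMilnorAnnals1963]
#9 KtRecognition (support) — the Kondo–Tanaka recognition theorem as a named Literature fact
(arXiv:1408.6036 Cor. 1.10 with Thm 1.3): compact smooth boundaryless manifolds M, N modelled on ℝⁿ
and a homeomorphism h : M ≃ₜ N with h, h⁻¹ locally Lipschitz and Clarke-regular in charts ⇒ Nonempty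
(M ≃ₘ N). Used as the hypothesis `(hF : KtRecognition)` of `closes`; a grounder may discharge it by
formalising the printed mollification proof. [difficulty: L] [KondoTanaka2017, Clarke1976]

TWO-LAYER PLAN. Foreseen glued splits (registered as BC3 skeletons, filed as Lines/birth.lean after
open, NOT as items now):
LipStandard ⇐ stub_almostLipStandard (a homeomorphism M ≃ₜ S⁴ continuous everywhere and locally
L-Lipschitz in charts off a closed
μH³-null set, both directions) → stub_ballRemovability (continuous on a ball + locally L-Lipschitz
off a closed H³-null set ⇒ L-Lipschitz
on the ball) → LipStandard. ClarkeRegularisation ⇐ stub_tameToPoint (improve a bi-Lipschitz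
comparison map to one Clarke-regular off
one point p and off h p) → stub_pointSingularityRemovable (an isolated two-sided Clarke singularity
of a bi-Lipschitz homeomorphism of
homotopy 4-spheres can be removed) → ClarkeRegularisation.

KILL CRITERIA. Refuting LipStandard (an exotic-LIP homotopy 4-sphere) closes the route outright
(`close --reason refuted:LipStandard`) and is itself a
disproof of SPC4-in-LIP, a major theorem. Refuting ClarkeRegularisation as typed forces the pivot
recorded in the sketch: move the cut to
"bi-Lipschitz with distortion < 1+ε" (Shikata rung) and re-split K1 accordingly. If Sullivan 1979 +
Quinn 8.1A + CGZ 2026 Thm 4.3 turn out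
to prove LipStandard outright, K1 becomes support and the route is re-split at K2 by the
singular-set ladder (tameToPoint /
pointSingularityRemovable become the cruxes). A proof of SPC4 elsewhere moots everything.

NOT DECOMPOSED YET. The quantitative-Quinn construction inside stub_almostLipStandard (handle
straightening with distortion control, Semmes/Heinonen–Wu
style decomposition-space estimates), the stratification of the Clarke-singular set of an extremal
bi-Lipschitz comparison map
(dimension bounds, porosity), the choice LIP vs QC of the cut (QC is the documented fallback), and
every constant (L, the H³-null
exceptional class) — all layer-2 or prover-side `--supports` lemmas, deliberately not items at open.

CHEAPEST FALSIFIER. Prove or refute stub_ballRemovability (pure real analysis: continuity + local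
L-Lipschitz off a closed H³-null subset of a ball in ℝ⁴ ⇒
L-Lipschitz on the ball, via a.e.-segment avoidance). A refuter can do it this week in Lean; if it
FAILS as typed (e.g. the H³-null
hypothesis must be strengthened to H³-finite-free or porous), K1's skeleton is re-cut, not the
route. Second cheapest: the literature
probe "does Sullivan 1979 Thm 2 + Quinn 8.1A + CGZ 2026 Thm 4.3 already give LipStandard?" (run
here: no — CGZ need the transition maps /
the given homeomorphism to be local C⁰-limits of bi-Lipschitz embeddings, which for Freedman's
homeomorphism is exactly the open point).

NUMBERS. Dimension 4 is the unique exception of Sullivan's LIP existence/uniqueness theorem (n ≠ 4: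
Sullivan 1979 Cor. 3; n = 4 fails: DS 1989
Thms 1–2). Exotic spheres that are bi-Lipschitz-standard by a map smooth off one point exist in
dimension 7 (28 classes; K–T Cor. 1.15 +
Kervaire–Milnor), calibrating why stub_pointSingularityRemovable must use dimension 4. Shikata1966:
bi-Lipschitz distortion < 1+ε(n) ⇒
diffeomorphic (the known LIP ⇒ DIFF ceiling below Clarke regularity).

DEFINITION REQUESTS. None outstanding: `Literature.Geometry.Manifold.{clarkeJacobian,
ClarkeRegularAt, LocallyLipschitzInCharts, ClarkeRegularInCharts,
KondoTanakaRecognition}` landed as p170520 (commit 179e582f340a). The BC5 rung landed as p171134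
(commit 6146a481d975):
`Literature.Geometry.Manifold.lipschitzWith_radialExt_and_leftInverse` (radial extension of mutually
inverse Lipschitz clutching maps
is a pair of mutually inverse Lipschitz maps — the analytic core of K–T Cor. 1.15, twisted spheres
are LIP-standard in every dimension).

Novelty: Searches (2026-08-17): `lit search --hybrid` ×3 ("Lipschitz structure 4-manifold uniqueness Sullivan
quasiconformal smooth" → gordon1984 pp.424/468, freedman1990 (0 Lipschitz lines on grep),
astala2008; "bi-Lipschitz homeomorphism diffeomorphic Clarke generalized Jacobian …" → textbooks
only); `lit vsearch` ×1 (→ gordon1984 p.468, kirby1989 pp.56/87, freedman1990 pp.101–104); `lit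
galaxy search --star all` ×4 ("Lipschitz structures|quasiconformal 4-manifolds|Lipschitz manifold" →
30 rows: panama:502725921996807 Cantrell 1979 (Sullivan; Siebenmann–Sullivan),
panama:460265875308567 Prospects in Topology, panama:497520421634112 Kirby–Siebenmann;
"Quasiconformal 4-manifolds|Lipschitz structures are unique|quasiconformal structures" → 20 rows:
Rickman, Vuorinen LNM 1508, pdf:3173689780 Semmes; two further needle sets → 0 hits); `lit citing
arxiv:1408.6036` (7: arXiv:2207.11017, 1904.00515, 1705.10178, 1811.04340 …); `lit citing
10.1007/bf02392736 --since 2010` (15: arXiv:2603.07731 read pp.1–3, 2510.19179, 2409.05825 …); `lit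
read` confirmations: cantrell1979 p.372 (Sullivan Thm 2 / Cor 3, n ≠ 4), pp.346–348
(Siebenmann–Sullivan Lemma 4), DS 1989 pp.2–3, K–T pp.5,7,13; `lean search --decl`
LipStandard|LocallyLipschitzInCharts|KondoTanaka (only p170520); bc/dedup2.lean `exact?` against
Mathlib + 65 Theses (4/4 not found); `ledger negatives --problem SmoothPoincare4` (0 statements).
Nearest prior art found: KondoTanaka2017 (arXiv:1408.6036: the recogniser Cor. 1.10; Cor. 1.15
twiste  [refs: 10.1007/bf02392736, 1408.6036, 2207.11017, 2603.07731, arxiv:1408.6036, KondoTanaka2017, DonaldsonSullivanActa1989, CristofarogardinerZhang2026, Shikata1966, Martin2013]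

Barriers (technique_class: LIP/QC Hauptvermutung, Clarke nonsmooth analysis): - technique_class: LIP/QC Hauptvermutung, Clarke nonsmooth analysis
- Literature.Barriers.SmoothPoincare4.TopologicalBarrierFour: evaded — neither crux is a
TOP-invariant detector; LIP is strictly finer than TOP in dimension 4 (DS 1989 Thm 2) and both
cruxes quantify over the smooth atlas (bi-Lipschitz / Clarke-regular in C^∞ charts).
- Literature.Barriers.SmoothPoincare4.GaugeSumBarrierFour: not engaged — no gauge invariant is
evaluated; conversely A2 is why no known (Donaldson-as-QC-invariant) obstruction can refute
LipStandard on a homotopy sphere (b₂ = 0).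
- Literature.Barriers.SmoothPoincare4.StableBarrierFour: not engaged — no stabilisation, no
S²×S²-stable invariant.
- Literature.Barriers.SmoothPoincare4.HCobordismInvariantBarrierFour: not engaged — no h-cobordism
invariant; Literature.Barriers.SmoothPoincare4.HCobordismBarrierFour: not used — no h-cobordism ⇒
diffeomorphism step (the recogniser is Kondo–Tanaka mollification).
- Literature.Barriers.SmoothPoincare4.TwistedSphereBarrierFour: not used — no Cerf/clutching step;
the LIP Alexander cone extension is a theorem in all dimensions
(`Literature.Geometry.Manifold.lipschitzWith_radialExt_and_leftInverse`, p171134, sorry-free), which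
is exactly the slack K1 exploits.
- Literature.Barriers.SmoothPoincare4.OpenAnalogueBarrierFour: ClarkeRegularisation and
KtRecognition are stated for CLOSED (compact) M only; the open analogue (a small exotic ℝ⁴
bi-Lipschitz to ℝ⁴ is standard) is deliberately not claimed.
- Literature.B

sub-problem: SmoothPoincare4 · status: open · opened planner-type-fe1c30e820-0 2026-08-17T17:21:35Z · rev 0 · ledger route-SmoothPoincare4-LipschitzHauptvermutung
GENERATED by the gate from the ledger (D-0016/17). Provers cite these decls: `theorem foo : Summit.SmoothPoincare4.SmoothPoincare4.Theses.LipschitzHauptvermutung.<Decl> := …` in Summits/SmoothPoincare4/SmoothPoincare4/Theorems/<Name>.lean.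
-/

namespace Summit.SmoothPoincare4.SmoothPoincare4.Theses.LipschitzHauptvermutung

open scoped BigOperators Topology Manifold Classical MeasureTheory ProbabilityTheory Matrix InnerProductSpace ComplexConjugate ContinuousMap
open Filter Set Function TopologicalSpace MeasureTheory

attribute [summit_statement] _root_.SmoothPoincare4

open Literature.SPC4

/-- item stmt-SmoothPoincare4-18748 · crux · rank 2 · open · by planner
why it might fail: LIP-approximation of homeomorphisms fails in dim 4 in general (DS 1989 Cor. p.183: CP²#8(−CP²) vs Barlow are homeomorphic, not bi-Lipschitz); an exotic S⁴ could carry an exotic LIP structure invisible to gauge theory (b₂ = 0), and Quinn 8.1A gives no metric control.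
sources: DonaldsonSullivanActa1989, Sullivan1979Hyperbolic, CristofarogardinerZhang2026, FreedmanQuinn1990, KondoTanaka2017, TukiaVaisala1981
[crux] K1 of the sketch — every smooth homotopy 4-sphere M (summit binders, M ≃ₕ S⁴) admits a
homeomorphism h : M ≃ₜ S⁴ with h and h⁻¹ locally Lipschitz in the extended charts (𝓡 4) at every
point. [difficulty: XL] -/
@[route_item "route-SmoothPoincare4-LipschitzHauptvermutung", crux]
def LipStandard : Prop :=
  open scoped ContDiff in (∀ (M : Type) [TopologicalSpace M] [T2Space M] [SecondCountableTopology M] [ChartedSpace (EuclideanSpace ℝ (Fin 4)) M] [IsManifold (𝓡 4) ∞ M], (M ≃ₕ (Metric.sphere (0 : EuclideanSpace ℝ (Fin 5)) 1)) → ∃ h : M ≃ₜ (Metric.sphere (0 : EuclideanSpace ℝ (Fin 5)) 1), Literature.Geometry.Manifold.LocallyLipschitzInCharts (𝓡 4) (𝓡 4) h ∧ Literature.Geometry.Manifold.LocallyLipschitzInCharts (𝓡 4) (𝓡 4) h.symm)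

/-- item stmt-SmoothPoincare4-18749 · crux · rank 3 · open · by planner
why it might fail: the 7-dimensional analogue is FALSE (every exotic S⁷ is bi-Lipschitz-standard by a map smooth off one point, KondoTanaka2017 Cor. 1.15), so the proof must use dimension 4; naive ε-regularity is false (logarithmic-spiral bi-Lipschitz maps have 0 in the Clarke hull); SPC4-shielded shape (§D.1).
sources: KondoTanaka2017, Clarke1976, Shikata1966, IwaniecMartin2001, KervaireMilnorAnnals1963
[crux] K2 of the sketch — for every smooth homotopy 4-sphere M: if some homeomorphism M ≃ₜ S⁴ is
locally Lipschitz in charts with its inverse, then some such homeomorphism is moreover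
Clarke-regular in charts in both directions (every element of the Clarke generalised Jacobian of
every chart representative is invertible). [deps: LipStandard] [difficulty: XL] -/
@[route_item "route-SmoothPoincare4-LipschitzHauptvermutung", crux]
def ClarkeRegularisation : Prop :=
  open scoped ContDiff in (∀ (M : Type) [TopologicalSpace M] [T2Space M] [SecondCountableTopology M] [ChartedSpace (EuclideanSpace ℝ (Fin 4)) M] [IsManifold (𝓡 4) ∞ M], (M ≃ₕ (Metric.sphere (0 : EuclideanSpace ℝ (Fin 5)) 1)) → (∃ h : M ≃ₜ (Metric.sphere (0 : EuclideanSpace ℝ (Fin 5)) 1), Literature.Geometry.Manifold.LocallyLipschitzInCharts (𝓡 4) (𝓡 4) h ∧ Literature.Geometry.Manifold.LocallyLipschitzInCharts (𝓡 4) (𝓡 4) h.symm) → ∃ h : M ≃ₜ (Metric.sphere (0 : EuclideanSpace ℝ (Fin 5)) 1), Literature.Geometry.Manifold.LocallyLipschitzInCharts (𝓡 4) (𝓡 4) h ∧ Literature.Geometry.Manifold.LocallyLipschitzInCharts (𝓡 4) (𝓡 4) h.symm ∧ Literature.Geometry.Manifold.ClarkeRegularInCharts (𝓡 4) (𝓡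 4) h ∧ Literature.Geometry.Manifold.ClarkeRegularInCharts (𝓡 4) (𝓡 4) h.symm)

/-- item stmt-SmoothPoincare4-18750 · support · rank 9 · open · by planner
sources: KondoTanaka2017, Clarke1976
[support] the Kondo–Tanaka recognition theorem as a named Literature fact (arXiv:1408.6036 Cor. 1.10
with Thm 1.3): compact smooth boundaryless manifolds M, N modelled on ℝⁿ and a homeomorphism h : M
≃ₜ N with h, h⁻¹ locally Lipschitz and Clarke-regular in charts ⇒ Nonempty (M ≃ₘ N). Used as the
hypothesis `(hF : KtRecognition)` of `closes`; a grounder may discharge it by formalising the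
printed mollification proof. [difficulty: L] -/
@[route_item "route-SmoothPoincare4-LipschitzHauptvermutung", crux]
def KtRecognition : Prop :=
  Literature.Geometry.Manifold.KondoTanakaRecognition

/-- item stmt-SmoothPoincare4-18751 · assembly · rank 1 · open · by planner
sources: KondoTanaka2017, FreedmanQuinn1990
[assembly] LipStandard → ClarkeRegularisation → KtRecognition → SmoothPoincare4 (pure logic plus
compactness of homotopy 4-spheres, `compactSpace_of_homotopyEquiv_sphere_four_holds`). -/
@[route_item "route-SmoothPoincare4-LipschitzHauptvermutung", crux]
def Assembly : Prop :=
  LipStandard → ClarkeRegularisation → KtRecognition → _root_.SmoothPoincare4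

/-! D-0027 §2.1 — DECIDING THEOREM (planner-authored via `route open/edit --closes-file`; by planner-type-fe1c30e820-0 2026-08-17T17:21:35Z):
its hypotheses are this route's items and its conclusion the sub-problem Statement (glue_lint), and it elaborates with this file. -/

@[closes "route-SmoothPoincare4-LipschitzHauptvermutung"] theorem closes (hA : Assembly) (h₁ : LipStandard) (h₂ : ClarkeRegularisation) (hF : KtRecognition) : _root_.SmoothPoincare4 :=
  hA h₁ h₂ hF

end Summit.SmoothPoincare4.SmoothPoincare4.Theses.LipschitzHauptvermutung
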